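import Summits.BirchSwinnertonDyer.BirchSwinnertonDyer.Theorems.SignedLowerHalvesSmallImageLowerHalfBothSignsRttJunctionShaLocCountSerre
import Summits.BirchSwinnertonDyer.BirchSwinnertonDyer.Theorems.SignedLowerHalvesSmallImageLowerHalfBothSignsRttJunctionLocalFrame
import HarnessLib

/-!
# Route `SignedLowerHalves`, crux L `SmallImageLowerHalfBothSigns` (stmt-BirchSwinnertonDyer-23599), line `rtt_w3` v31 — stub S3α′ (`stub_junctionShaPT_ns`),
# brick α2-lev (part 9, PASTE FORM): the `ρ`-half of S3α′ with the binders of the registered stub VERBATIM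

INPUTS hand `bsd-inputs-honda-p1` g28 under LEAD `cruxlead-stmt-BirchSwinnertonDyer-23599` g14 (cell `bsd-ssimc`); helper `--supports stmt-BirchSwinnertonDyer-23599`. THEOREMS ONLY.

WHAT. ★★★ `exists_rhoTwo_finite_of_frame` — part 8's `exists_rhoTwo_finite_of_frameSupp_of_goodSS` re-keyed on the binders the registered stub `stub_junctionShaPT_ns` actually carries:
`hS : 0 < finrank_{ℚ_p} ℚ_p(S)` instead of the `FiniteDimensional` instance; the frame's `χ₀`, `hθfin : ∃ m > 0, χ₀^m = 1` and `hker : θ′ = χ₀` on `Gal(K̄/K̃_∞)` instead of the inertia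
exponent `hθm` (derived by -w3's `SmallImageRttJunctionLocal.apply_pow_eq_one_of_mem_inertia`); `(R)` = the first conjunct of the line-file `CharRoadFrameSupp S 𝔣 θ′`; `hNP` as the
assembly's frame plumbing; `GoodSS` = `hX7.1`. Conclusion: a FINITE `Λ`-module `Loc` and a `Λ`-linear `ρ : I.H → Loc` (`letI := I.moduleIwasawa`) with
`ρ b = 0 ↔ ∀ w ∈ supp(p𝔣), ∀ n k δ, loc²_w(conj_δ (I.proj n k b)) = 0` — so that with α5′'s `π` (`(∀ w n k δ, loc² = 0) → b ∈ range π`) the stub's `ker ρ ≤ range π` is two lines.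
HONEST FRAMING: the `ρ`/finiteness half of S3α′ only; α5′ (`π`, -w3 lineage) is NOT proved here; nothing about S3α′ as registered, E2, crux L or BSD is proved; all remain OPEN and
are proved for NO curve.
References: [Serre1972] §1.11 Prop. 12 c); [NeukirchSchmidtWingberg2008] (8.6.3), (8.6.10); [PerrinRiou1994Invent] §1.3; [Washington1997] §13.1–13.2.
-/

set_option autoImplicit false
set_option linter.dupNamespace false -- D-0017: single-problem summit, the namespace repeats the problem name by design
noncomputable section

open scoped Classical
open NumberField IsDedekindDomain Field Function

namespace Summit.BirchSwinnertonDyer.BirchSwinnertonDyer.Theorems.SmallImageRttJunctionSha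

open Literature.NumberTheory.EllipticCurves Literature.NumberTheory.GaloisRepresentations
  Literature.NumberTheory.ComplexMultiplication.EllipticUnits.JohnsonLeungKings2011
  WeierstrassCurve

section Frame

variable {K : Type} [Field K] [NumberField K] {p : ℕ} [hp : Fact p.Prime] (hp2 : p ≠ 2) {κ : ZpExtension ℚ p} (hK2 : Module.finrank ℚ K = 2)

/-- ★★★ **THE `ρ`-HALF OF S3α′ IN THE STUB'S OWN BINDERS.** For the prefix/frame data of `stub_junctionShaPT_ns` — `p ≠ 2`, `[K:ℚ] = 2`, `0 < [ℚ_p(S):ℚ_p]`, `κ` cyclotomic with top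
generator `γ` a cyclotomic variable, `W/ℚ` globally minimal with good reduction at `p` and `p ∣ a_p(W)` (`GoodSS = hX7.1`), the frame's `θ` and `j : (W ⊗ K)[p^∞] → Cofree θ` equivariant
above `p` with `𝒪 · range j = ⊤`, `vp = (p)`, `p ∤ d_K`, a frame `(κ₂, 𝔣, χ₀, θ′)` with `θ′·θ₀₀ = 1`, `χ₀` of finite order, `θ′ = χ₀` on `Gal(K̄/K̃_∞)`, (R) of `CharRoadFrameSupp`,
`𝔣 ≠ 0`, `N_{supp p𝔣} ≤ U_n` — and ANY degree-2 cyclotomic Iwasawa cohomology datum `I` at `supp(p𝔣)` (any `γK`, e.g. the stub's `γK⁻¹`): a finite `Λ`-module `Loc` and a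
`Λ`-linear `ρ : I.H → Loc` whose kernel is the levelwise `Ш²`. [cite: Serre1972, §1.11 Prop. 12 c)] [cite: NeukirchSchmidtWingberg2008, (8.6.3), (8.6.10)]
[cite: PerrinRiou1994Invent, §1.3] [cite: Washington1997, §13.2] -/
theorem exists_rhoTwo_finite_of_frame (S : Set (PadicAlgCl p)) (hS : 0 < Module.finrank ℚ_[p] (padicCoeffField S))
    (hκ : κ.IsCyclotomic) {γ : absoluteGaloisGroup ℚ} (hγ : κ.IsTopGenerator γ) (hcv : IsCyclotomicVariable p γ)
    (θ : FramedGaloisRep K (padicCoeffIntegers S) 1)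
    (W : WeierstrassCurve ℚ) [W.IsElliptic] [W.IsGloballyMinimal] (hgood : W.HasGoodReductionAtPrime p) (hap : (p : ℤ) ∣ W.frobeniusTrace p)
    (j : (W.baseChange K).geomPrimaryTorsion p →+ GreenbergSelmer.Cofree θ (padicCoeffField S))
    (hj : ∀ v : HeightOneSpectrum (𝓞 K), ((p : ℕ) : 𝓞 K) ∈ v.asIdeal →
      ∀ (δ : absoluteGaloisGroup (v.adicCompletion K)) (t : (W.baseChange K).geomPrimaryTorsion p),
        j (resGalOfEmb (closureEmb (K := K) (v.adicCompletion K)) δ • t) = resGalOfEmb (closureEmb (K := K) (v.adicCompletion K)) δ • j t)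
    (hjspan : Submodule.span (padicCoeffIntegers S) (Set.range j) = ⊤)
    (vp : HeightOneSpectrum (𝓞 K)) (hv : vp.asIdeal = Ideal.span {((p : ℕ) : 𝓞 K)}) (hnd : ¬ (p : ℤ) ∣ NumberField.discr K)
    (κ₂ : ZpExtension K p) (𝔣 : Ideal (𝓞 K)) (χ₀ θ' : absoluteGaloisGroup K →ₜ* (padicCoeffIntegers S)ˣ)
    (hθ'θ : ∀ g : absoluteGaloisGroup K, ((θ' g : (padicCoeffIntegers S)ˣ) : padicCoeffIntegers S) *
      ((θ g : GL (Fin 1) (padicCoeffIntegers S)) : Matrix (Fin 1) (Fin 1) (padicCoeffIntegers S)) 0 0 = 1)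
    (hθfin : ∃ m : ℕ, 0 < m ∧ ∀ τ : absoluteGaloisGroup K, χ₀ τ ^ m = 1)
    (hker : ∀ τ ∈ ZpExtension.pairKer (κ.restrictOfFinrankEqTwo hp2 K hK2) κ₂, θ' τ = χ₀ τ)
    (hR : ∀ w ∈ suppPF p 𝔣, ((p : ℕ) : 𝓞 K) ∉ w.asIdeal → ∃ 𝔓 ∈ w.primesAbove, ∃ τ ∈ 𝔓.inertia (absoluteGaloisGroup K), θ' τ ≠ 1)
    (h𝔣 : 𝔣 ≠ ⊥)
    (hNP : ∀ n, ramificationSubgroup K (suppPF p 𝔣) ≤ (κ.restrictOfFinrankEqTwo hp2 K hK2).layerSubgroup n)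
    {γK : absoluteGaloisGroup K}
    (I : SmallImageRttD2J1.CycIwasawaCohomologyDataO S (κ.restrictOfFinrankEqTwo hp2 K hK2) γK θ' (suppPF p 𝔣) 2) :
    letI := I.moduleIwasawa
    ∃ (Loc : Type) (_ : AddCommGroup Loc) (_ : Module (IwasawaAlgebra p) Loc) (_ : Finite Loc) (ρ : I.H →ₗ[IwasawaAlgebra p] Loc),
      ∀ b : I.H, ρ b = 0 ↔ ∀ w ∈ suppPF p 𝔣, ∀ (n k : ℕ) (δ : absoluteGaloisGroup K),
        ContinuousCohomology.map (SmallImageRttD2Seq.locLayerHom (κ.restrictOfFinrankEqTwo hp2 K hK2) (suppPF p 𝔣) w n)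
          (SmallImageRttD2Seq.locLayerMod S (κ.restrictOfFinrankEqTwo hp2 K hK2) θ' (suppPF p 𝔣) w n k) 2
          (SmallImageRttD2J1.cycLayerConjO S (κ.restrictOfFinrankEqTwo hp2 K hK2) θ' (suppPF p 𝔣) n k 2 δ (I.proj n k b)) = 0 := by
  haveI : FiniteDimensional ℚ_[p] (padicCoeffField S) := Module.finite_of_finrank_pos hS
  obtain ⟨m₀, hm₀, hχ₀m⟩ := hθfin
  exact exists_rhoTwo_finite_of_frameSupp_of_goodSS hp2 hK2 S hκ hγ hcv θ θ' hθ'θ W hgood hap j hj hjspan h𝔣 hR hm₀.ne'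
    (fun w hwp ↦ SmallImageRttJunctionLocal.apply_pow_eq_one_of_mem_inertia (κ.restrictOfFinrankEqTwo hp2 K hK2) κ₂ hχ₀m hker hwp) vp hv hnd hNP I

/-- **The two-line closing pattern of S3α′ from its halves** (generic): if `ρ b = 0 ↔ P b` (this lineage's `ρ`-half) and `P b → b ∈ range π` (α5′, -w3's `π`-half), then
`ker ρ ≤ range π`. Stated for arbitrary additive maps so that the stub's `Λ`-linear `ρ, π` (coerced) are an instance. [folklore] -/
theorem ker_le_range_of_halves {R : Type*} [Semiring R] {H Loc Y : Type*} [AddCommGroup H] [AddCommGroup Loc] [AddCommGroup Y]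
    [Module R H] [Module R Loc] [Module R Y] (ρ : H →ₗ[R] Loc) (π : Y →ₗ[R] H) (P : H → Prop)
    (hρ : ∀ b : H, ρ b = 0 ↔ P b) (hπ : ∀ b : H, P b → b ∈ LinearMap.range π) :
    LinearMap.ker ρ ≤ LinearMap.range π := fun b hb ↦ hπ b ((hρ b).mp (LinearMap.mem_ker.mp hb))

/-- ★★★ **S3α′ FROM ITS `π`-HALF (α5′), CLOSING FORM.** Same binders as `exists_rhoTwo_finite_of_frame`; given ANY `Λ`-module `Y` (the stub's `Y′ = strictSelmer … →+ AddCircle` with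
lambda-p1's `strictDualModule`, say) and a `Λ`-linear `π : Y → I.H` (for `I.moduleIwasawa`) onto the levelwise `Ш²` — α5′: «`(∀ w ∈ supp(p𝔣), ∀ n k δ, loc²_w(conj_δ (I.proj n k b)) = 0) → b ∈ range π`»
— the registered conclusion of `stub_junctionShaPT_ns` follows: a finite `Λ`-module `Loc`, `ρ : I.H →ₗ[Λ] Loc` and `π` with `ker ρ ≤ range π`. (So S3α′ = α5′ + this lineage's parts 1–9.)
[cite: Serre1972, §1.11 Prop. 12 c)] [cite: NeukirchSchmidtWingberg2008, (8.6.3), (8.6.10)] [cite: PerrinRiou1994Invent, §1.3] -/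
theorem exists_rho_pi_of_frame (S : Set (PadicAlgCl p)) (hS : 0 < Module.finrank ℚ_[p] (padicCoeffField S))
    (hκ : κ.IsCyclotomic) {γ : absoluteGaloisGroup ℚ} (hγ : κ.IsTopGenerator γ) (hcv : IsCyclotomicVariable p γ)
    (θ : FramedGaloisRep K (padicCoeffIntegers S) 1)
    (W : WeierstrassCurve ℚ) [W.IsElliptic] [W.IsGloballyMinimal] (hgood : W.HasGoodReductionAtPrime p) (hap : (p : ℤ) ∣ W.frobeniusTrace p)
    (j : (W.baseChange K).geomPrimaryTorsion p →+ GreenbergSelmer.Cofree θ (padicCoeffField S))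
    (hj : ∀ v : HeightOneSpectrum (𝓞 K), ((p : ℕ) : 𝓞 K) ∈ v.asIdeal →
      ∀ (δ : absoluteGaloisGroup (v.adicCompletion K)) (t : (W.baseChange K).geomPrimaryTorsion p),
        j (resGalOfEmb (closureEmb (K := K) (v.adicCompletion K)) δ • t) = resGalOfEmb (closureEmb (K := K) (v.adicCompletion K)) δ • j t)
    (hjspan : Submodule.span (padicCoeffIntegers S) (Set.range j) = ⊤)
    (vp : HeightOneSpectrum (𝓞 K)) (hv : vp.asIdeal = Ideal.span {((p : ℕ) : 𝓞 K)}) (hnd : ¬ (p : ℤ) ∣ NumberField.discr K)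
    (κ₂ : ZpExtension K p) (𝔣 : Ideal (𝓞 K)) (χ₀ θ' : absoluteGaloisGroup K →ₜ* (padicCoeffIntegers S)ˣ)
    (hθ'θ : ∀ g : absoluteGaloisGroup K, ((θ' g : (padicCoeffIntegers S)ˣ) : padicCoeffIntegers S) *
      ((θ g : GL (Fin 1) (padicCoeffIntegers S)) : Matrix (Fin 1) (Fin 1) (padicCoeffIntegers S)) 0 0 = 1)
    (hθfin : ∃ m : ℕ, 0 < m ∧ ∀ τ : absoluteGaloisGroup K, χ₀ τ ^ m = 1)
    (hker : ∀ τ ∈ ZpExtension.pairKer (κ.restrictOfFinrankEqTwo hp2 K hK2) κ₂, θ' τ = χ₀ τ)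
    (hR : ∀ w ∈ suppPF p 𝔣, ((p : ℕ) : 𝓞 K) ∉ w.asIdeal → ∃ 𝔓 ∈ w.primesAbove, ∃ τ ∈ 𝔓.inertia (absoluteGaloisGroup K), θ' τ ≠ 1)
    (h𝔣 : 𝔣 ≠ ⊥)
    (hNP : ∀ n, ramificationSubgroup K (suppPF p 𝔣) ≤ (κ.restrictOfFinrankEqTwo hp2 K hK2).layerSubgroup n)
    {γK : absoluteGaloisGroup K}
    (I : SmallImageRttD2J1.CycIwasawaCohomologyDataO S (κ.restrictOfFinrankEqTwo hp2 K hK2) γK θ' (suppPF p 𝔣) 2)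
    (Y : Type) [AddCommGroup Y] [Module (IwasawaAlgebra p) Y] :
    letI := I.moduleIwasawa
    ∀ π : Y →ₗ[IwasawaAlgebra p] I.H,
      (∀ b : I.H, (∀ w ∈ suppPF p 𝔣, ∀ (n k : ℕ) (δ : absoluteGaloisGroup K),
        ContinuousCohomology.map (SmallImageRttD2Seq.locLayerHom (κ.restrictOfFinrankEqTwo hp2 K hK2) (suppPF p 𝔣) w n)
          (SmallImageRttD2Seq.locLayerMod S (κ.restrictOfFinrankEqTwo hp2 K hK2) θ' (suppPF p 𝔣) w n k) 2
          (SmallImageRttD2J1.cycLayerConjO S (κ.restrictOfFinrankEqTwo hp2 K hK2) θ' (suppPF p 𝔣) n k 2 δ (I.proj n k b)) = 0) → b ∈ LinearMap.range π) →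
      ∃ (Loc : Type) (_ : AddCommGroup Loc) (_ : Module (IwasawaAlgebra p) Loc) (_ : Finite Loc) (ρ : I.H →ₗ[IwasawaAlgebra p] Loc)
        (π' : Y →ₗ[IwasawaAlgebra p] I.H), LinearMap.ker ρ ≤ LinearMap.range π' := by
  letI := I.moduleIwasawa
  intro π hπ
  obtain ⟨Loc, i1, i2, i3, ρ, hρ⟩ := exists_rhoTwo_finite_of_frame hp2 hK2 S hS hκ hγ hcv θ W hgood hap j hj hjspan vp hv hnd κ₂ 𝔣 χ₀ θ' hθ'θ hθfin hker hR h𝔣 hNP I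
  exact ⟨Loc, i1, i2, i3, ρ, π, ker_le_range_of_halves ρ π _ hρ hπ⟩

end Frame

end Summit.BirchSwinnertonDyer.BirchSwinnertonDyer.Theorems.SmallImageRttJunctionSha

end
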